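import Literature.Probability.RandomPlanarGeometry.PlusHullKoebe
import Literature.Probability.RandomPlanarGeometry.ExcursionKernelIdentity
import Literature.Probability.RandomPlanarGeometry.RestrictionMapProofs
import Mathlib.Analysis.Complex.RealDeriv
import Mathlib.Analysis.SpecificLimits.RCLike
import HarnessLib

/-!
# Möbius images of `+`-hulls hung between two points of `(−∞, 0)` and their restriction derivatives

Topic `Probability/RandomPlanarGeometry`; support for the one-sided restriction measures `P⁺_β`
of Lawler–Schramm–Werner, *Conformal restriction: the chordal case*, J. Amer. Math. Soc. **16**
(2003) (**[LSW]**, arXiv:math/0209343), §8. Piece 2 of the construction (carried out in sibling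
files) of `P⁺_β` for every `β > 0` as the left filling of a Poisson cloud of Möbius images of
two-sided restriction samples `K ~ P_1` hung between pairs of points of `(−∞, 0)`, which exhibits
`P⁺_β{i ∈ K} > 0` (the positivity behind the comparison sentence of the proof of [LSW] Cor. 8.6).

For reals `x < y` let `m_{x,y}(z) = (yz + x)/(z + 1)` (`excMap`), the Möbius automorphism of `ℍ`
with `m(0) = x`, `m(∞) = y`, and `m⁻¹(w) = (x − w)/(w − y)` (`excInv`). For a `+`-hull `A ∈ 𝒬₊`
([LSW] §2) and `x < y < 0` the set `B = m⁻¹(A)` (`excHull x y A`) is a `−`-hull (`IsMinusHull`,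
hence in `𝒬*`): it hangs on a segment of `(−∞, 0)`, and a two-sided restriction sample `K`
from `0` to `∞` avoids `B` iff its image `m(K)`, a sample hung between `x` and `y`, avoids `A`.
Its restriction derivative is computed from the Schwarz-reflection extension `E_A` of `Φ_A`
(`PlusHullExtension`) and its real trace `φ = realExt`:

  `Φ'_B(0) = φ'(x) φ'(y) (y − x)² / (φ(y) − φ(x))²`   (`excDeriv`),

the restriction map of `B` being `n ∘ Φ_A ∘ m` with `n(u) = c (u − φ(x))/(φ(y) − u)`,
`c = φ'(y)(y − x)/(φ(y) − φ(x))` (`excRestrictionMap`, `isRestrictionMap_excRestrictionMap`,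
`hasRestrictionDeriv_excRestrictionMap`). This is the conformal covariance of the boundary
Poisson kernel, `H_{ℍ∖A}(x, y)/H_ℍ(x, y) = Φ'_B(0)`, so that every two-sided restriction measure
gives `P_α[K ∩ B = ∅] = Φ'_B(0)^α` (`IsRestrictionMeasure.measure_avoid_excHull`). Since
`Φ'_B(0) ≤ 1`, the kernel `(x − y)⁻² (1 − Φ'_B(0)) = (x − y)⁻² − φ'(x)φ'(y)(φ(x) − φ(y))⁻²` is
nonnegative, and the excursion-kernel identity of `ExcursionKernelIdentity` yields

  `∫⁻_{(−∞,0)²} (x − y)⁻² (1 − Φ'_{B_{x,y}}(0)) d(x, y) = −log Φ'_A(0)`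

(`setLIntegral_prod_one_sub_excDeriv`): the mass, under `(x − y)⁻² dx dy ⊗ P_1`, of hung samples
hitting `A`. All statements are proved; the only literature inputs are the tree's discharged facts
on `Φ_A` (existence, uniqueness, `0 < Φ'_A(0) ≤ 1`).

## References

* [LSW] §2 (hulls, `Φ_A`), §8.1–8.2 (one-sided restriction). [LawlerSchrammWerner2003Restriction]
-/

noncomputable section

open Set Filter Topology Complex MeasureTheory
open UpperHalfPlane (upperHalfPlaneSet)
open scoped ComplexConjugate ENNReal

namespace Literature.Probability.RandomPlanarGeometry

/-! ### The Möbius maps `m_{x,y}` and `m_{x,y}⁻¹` -/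

/-- **`m_{x,y}(z) = (yz + x)/(z + 1)`**: for `x < y` the Möbius automorphism of `ℍ` with
`m(0) = x`, `m(∞) = y` (and `m(−1) = ∞`). [folklore] -/
def excMap (x y : ℝ) (z : ℂ) : ℂ := ((y : ℂ) * z + x) / (z + 1)

/-- **`m_{x,y}⁻¹(w) = (x − w)/(w − y)`**. [folklore] -/
def excInv (x y : ℝ) (w : ℂ) : ℂ := ((x : ℂ) - w) / (w - y)

section Moebius

variable {x y : ℝ} {z w : ℂ}

/-- `m(0) = x`. [folklore] -/
@[simp] theorem excMap_zero (x y : ℝ) : excMap x y 0 = x := by simp [excMap]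

/-- `m⁻¹(x) = 0`. [folklore] -/
@[simp] theorem excInv_self (x y : ℝ) : excInv x y x = 0 := by simp [excInv]

/-- `m(z) = y + (x − y)/(z + 1)` off the pole. [folklore] -/
theorem excMap_eq (hz : z ≠ -1) : excMap x y z = y + ((x : ℂ) - y) / (z + 1) := by
  have hz1 : z + 1 ≠ 0 := fun h ↦ hz (eq_neg_of_add_eq_zero_left h)
  rw [excMap]
  field_simp
  ring

/-- `m(z) − x = (y − x) z/(z + 1)` off the pole. [folklore] -/
theorem excMap_sub_left (hz : z ≠ -1) : excMap x y z - x = ((y : ℂ) - x) * z / (z + 1) := by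
  have hz1 : z + 1 ≠ 0 := fun h ↦ hz (eq_neg_of_add_eq_zero_left h)
  rw [excMap]
  field_simp
  ring

/-- `m⁻¹ ∘ m = id` off the pole. [folklore] -/
theorem excInv_excMap (hxy : x ≠ y) (hz : z ≠ -1) : excInv x y (excMap x y z) = z := by
  have hz1 : z + 1 ≠ 0 := fun h ↦ hz (eq_neg_of_add_eq_zero_left h)
  have hxy' : (x : ℂ) - y ≠ 0 := sub_ne_zero.2 (by exact_mod_cast hxy)
  rw [excInv, excMap]
  have h1 : (x : ℂ) - ((y : ℂ) * z + x) / (z + 1) = ((x : ℂ) - y) * z / (z + 1) := by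
    field_simp
    ring
  have h2 : ((y : ℂ) * z + x) / (z + 1) - y = ((x : ℂ) - y) / (z + 1) := by
    field_simp
    ring
  rw [h1, h2]
  field_simp

/-- `m ∘ m⁻¹ = id` off the pole. [folklore] -/
theorem excMap_excInv (hxy : x ≠ y) (hw : w ≠ y) : excMap x y (excInv x y w) = w := by
  have hwy : w - y ≠ 0 := sub_ne_zero.2 hw
  have hxy' : (x : ℂ) - y ≠ 0 := sub_ne_zero.2 (by exact_mod_cast hxy)
  rw [excInv, excMap]
  have h1 : (y : ℂ) * (((x : ℂ) - w) / (w - y)) + x = w * ((x : ℂ) - y) / (w - y) := by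
    field_simp
    ring
  have h2 : ((x : ℂ) - w) / (w - y) + 1 = ((x : ℂ) - y) / (w - y) := by
    field_simp
    ring
  rw [h1, h2]
  field_simp

/-- `m⁻¹(w) ≠ −1` (for `x ≠ y`). [folklore] -/
theorem excInv_ne_neg_one (hxy : x ≠ y) (w : ℂ) : excInv x y w ≠ -1 := by
  intro h
  rw [excInv] at h
  by_cases hwy : w - y = 0
  · simp [hwy] at h
  · rw [div_eq_iff hwy] at h
    have : (x : ℂ) = y := by linear_combination h
    exact hxy (by exact_mod_cast this)

/-- `m(z) ≠ y` (for `x ≠ y` and `y ≠ 0`). [folklore] -/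
theorem excMap_ne (hxy : x ≠ y) (hy : y ≠ 0) (z : ℂ) : excMap x y z ≠ y := by
  intro h
  rw [excMap] at h
  by_cases hz1 : z + 1 = 0
  · simp [hz1] at h
    exact hy (by exact_mod_cast h.symm)
  · rw [div_eq_iff hz1] at h
    have : (x : ℂ) = y := by linear_combination h
    exact hxy (by exact_mod_cast this)

/-- **`Im m(z) = (y − x) Im z/|z + 1|²`.** [folklore] -/
theorem excMap_im (x y : ℝ) (z : ℂ) : (excMap x y z).im = (y - x) * z.im / normSq (z + 1) := by
  rw [excMap, div_im]
  simp only [add_re, mul_re, ofReal_re, ofReal_im, zero_mul, sub_zero, add_im, mul_im, add_zero,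
    one_re, one_im]
  by_cases h : normSq (z + 1) = 0
  · simp [h]
  · field_simp
    ring

/-- **`Im m⁻¹(w) = (y − x) Im w/|w − y|²`.** [folklore] -/
theorem excInv_im (x y : ℝ) (w : ℂ) : (excInv x y w).im = (y - x) * w.im / normSq (w - y) := by
  rw [excInv, div_im]
  simp only [sub_re, ofReal_re, sub_im, ofReal_im, sub_zero, zero_sub]
  by_cases h : normSq (w - (y : ℂ)) = 0
  · simp [h]
  · field_simp
    ring

/-- `m` maps `ℍ` into `ℍ` (`x < y`). [folklore] -/
theorem excMap_mem_upperHalfPlaneSet (hxy : x < y) {z : ℂ} (hz : z ∈ upperHalfPlaneSet) :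
    excMap x y z ∈ upperHalfPlaneSet := by
  have hz' : 0 < z.im := hz
  have hz1 : z + 1 ≠ 0 := by
    intro h
    have : (z + 1).im = 0 := by rw [h]; simp
    simp at this
    linarith
  show 0 < (excMap x y z).im
  rw [excMap_im]
  exact div_pos (mul_pos (sub_pos.2 hxy) hz') (normSq_pos.2 hz1)

/-- `m⁻¹` maps `ℍ` into `ℍ` (`x < y`). [folklore] -/
theorem excInv_mem_upperHalfPlaneSet (hxy : x < y) {w : ℂ} (hw : w ∈ upperHalfPlaneSet) :
    excInv x y w ∈ upperHalfPlaneSet := by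
  have hw' : 0 < w.im := hw
  have hwy : w - y ≠ 0 := by
    intro h
    have : (w - y).im = 0 := by rw [h]; simp
    simp at this
    linarith
  show 0 < (excInv x y w).im
  rw [excInv_im]
  exact div_pos (mul_pos (sub_pos.2 hxy) hw') (normSq_pos.2 hwy)

/-- `Im m⁻¹(w) > 0 ↔ Im w > 0` for `w ≠ y` (`x < y`). [folklore] -/
theorem excInv_im_pos_iff (hxy : x < y) {w : ℂ} (hw : w ≠ y) : 0 < (excInv x y w).im ↔ 0 < w.im := by
  have hn : 0 < normSq (w - y) := normSq_pos.2 (sub_ne_zero.2 hw)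
  rw [excInv_im, div_pos_iff_of_pos_right hn, mul_pos_iff_of_pos_left (sub_pos.2 hxy)]

/-- `Im m⁻¹(w) = 0 ↔ Im w = 0` for `w ≠ y` (`x < y`). [folklore] -/
theorem excInv_im_eq_zero_iff (hxy : x < y) {w : ℂ} (hw : w ≠ y) : (excInv x y w).im = 0 ↔ w.im = 0 := by
  have hn : normSq (w - y) ≠ 0 := (normSq_pos.2 (sub_ne_zero.2 hw)).ne'
  rw [excInv_im, div_eq_zero_iff, mul_eq_zero]
  simp [hn, (sub_pos.2 hxy).ne']

/-- `m` is differentiable off the pole `−1`. [folklore] -/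
theorem differentiableAt_excMap (hz : z ≠ -1) : DifferentiableAt ℂ (excMap x y) z := by
  have hz1 : z + 1 ≠ 0 := fun h ↦ hz (eq_neg_of_add_eq_zero_left h)
  unfold excMap
  fun_prop (disch := exact hz1)

/-- `m⁻¹` is differentiable off the pole `y`. [folklore] -/
theorem differentiableAt_excInv (hw : w ≠ (y : ℂ)) : DifferentiableAt ℂ (excInv x y) w := by
  have hwy : w - y ≠ 0 := sub_ne_zero.2 hw
  unfold excInv
  fun_prop (disch := exact hwy)

/-- `m` is continuous off the pole. [folklore] -/
theorem continuousAt_excMap (hz : z ≠ -1) : ContinuousAt (excMap x y) z :=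
  (differentiableAt_excMap hz).continuousAt

/-- `m⁻¹` is continuous off the pole. [folklore] -/
theorem continuousAt_excInv (hw : w ≠ (y : ℂ)) : ContinuousAt (excInv x y) w :=
  (differentiableAt_excInv hw).continuousAt

/-- `m⁻¹` is continuous on any set avoiding the pole. [folklore] -/
theorem continuousOn_excInv {S : Set ℂ} (hS : (y : ℂ) ∉ S) : ContinuousOn (excInv x y) S :=
  fun w hw ↦ (continuousAt_excInv (w := w) fun h ↦ hS (h ▸ hw)).continuousWithinAt

/-- `m` is continuous on any set avoiding the pole. [folklore] -/
theorem continuousOn_excMap {S : Set ℂ} (hS : (-1 : ℂ) ∉ S) : ContinuousOn (excMap x y) S :=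
  fun z hz ↦ (continuousAt_excMap (z := z) fun h ↦ hS (h ▸ hz)).continuousWithinAt

end Moebius

/-! ### The hung hull `B = m_{x,y}⁻¹(A)` -/

/-- **`m_{x,y}⁻¹(A)`**, the image of the `+`-hull `A` under `m⁻¹`: a hull hung on a segment of
`(−∞, 0)` (for `x < y < 0`), avoided by a configuration `K` from `0` to `∞` iff the hung
configuration `m(K)` (from `x` to `y`) avoids `A`. [folklore] -/
def excHull (x y : ℝ) (A : Set ℂ) : Set ℂ := excInv x y '' A

section Hull

variable {A : Set ℂ} {x y : ℝ}

/-- No point of a `+`-hull is the (negative) pole `y`. [folklore] -/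
theorem IsPlusHull.ne_pole (hA : IsPlusHull A) (hy : y < 0) {a : ℂ} (ha : a ∈ A) : a ≠ (y : ℂ) := by
  rintro rfl
  linarith [hA.2 y ha]

/-- `y ∉ A`. [folklore] -/
theorem IsPlusHull.pole_notMem (hA : IsPlusHull A) (hy : y < 0) : ((y : ℝ) : ℂ) ∉ A :=
  fun h ↦ hA.ne_pole hy h rfl

/-- `x ∉ A` for `x < 0`. [folklore] -/
theorem IsPlusHull.ofReal_notMem_of_neg (hA : IsPlusHull A) (hx : x < 0) : ((x : ℝ) : ℂ) ∉ A :=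
  fun h ↦ by linarith [hA.2 x h]

/-- `m ∘ m⁻¹ = id` on `A`. [folklore] -/
theorem IsPlusHull.excMap_excInv_of_mem (hA : IsPlusHull A) (hxy : x < y) (hy : y < 0) {a : ℂ} (ha : a ∈ A) :
    excMap x y (excInv x y a) = a :=
  excMap_excInv hxy.ne (hA.ne_pole hy ha)

/-- `m⁻¹` is injective on `ℂ ∖ {y}`, in particular on `A`. [folklore] -/
theorem IsPlusHull.injOn_excInv (hA : IsPlusHull A) (hxy : x < y) (hy : y < 0) : InjOn (excInv x y) A := by
  intro a ha b hb h
  rw [← hA.excMap_excInv_of_mem hxy hy ha, ← hA.excMap_excInv_of_mem hxy hy hb, h]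

/-- `B` is compact. [folklore] -/
theorem IsPlusHull.isCompact_excHull (hA : IsPlusHull A) (hy : y < 0) : IsCompact (excHull x y A) :=
  hA.1.1.isCompact.image_of_continuousOn (continuousOn_excInv (hA.pole_notMem hy))

/-- `B ∩ ℍ = m⁻¹(A ∩ ℍ)`. [folklore] -/
theorem IsPlusHull.excHull_inter (hA : IsPlusHull A) (hxy : x < y) (hy : y < 0) :
    excHull x y A ∩ upperHalfPlaneSet = excInv x y '' (A ∩ upperHalfPlaneSet) := by
  ext b
  constructor
  · rintro ⟨⟨a, ha, rfl⟩, hb⟩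
    exact ⟨a, ⟨ha, (excInv_im_pos_iff hxy (hA.ne_pole hy ha)).1 hb⟩, rfl⟩
  · rintro ⟨a, ⟨ha, haH⟩, rfl⟩
    exact ⟨⟨a, ha, rfl⟩, excInv_mem_upperHalfPlaneSet hxy haH⟩

/-- `ℍ ∖ B = m⁻¹(ℍ ∖ A)`. [folklore] -/
theorem IsPlusHull.diff_excHull (hA : IsPlusHull A) (hxy : x < y) (hy : y < 0) :
    upperHalfPlaneSet \ excHull x y A = excInv x y '' (upperHalfPlaneSet \ A) := by
  ext b
  constructor
  · rintro ⟨hb, hbB⟩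
    have hb1 : b ≠ -1 := by
      rintro rfl
      simp [UpperHalfPlane.upperHalfPlaneSet] at hb
    refine ⟨excMap x y b, ⟨excMap_mem_upperHalfPlaneSet hxy hb, fun hbA ↦ hbB ?_⟩, excInv_excMap hxy.ne hb1⟩
    exact ⟨excMap x y b, hbA, excInv_excMap hxy.ne hb1⟩
  · rintro ⟨a, ⟨ha, haA⟩, rfl⟩
    refine ⟨excInv_mem_upperHalfPlaneSet hxy ha, ?_⟩
    rintro ⟨a', ha', h⟩
    have ha'y := hA.ne_pole hy ha'
    have hay : a ≠ (y : ℂ) := by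
      rintro rfl
      simp [UpperHalfPlane.upperHalfPlaneSet] at ha
    have : a' = a := by rw [← excMap_excInv hxy.ne ha'y, ← excMap_excInv hxy.ne hay, h]
    exact haA (this ▸ ha')

/-- The real points of `B` are negative. [folklore] -/
theorem IsPlusHull.excHull_real_neg (hA : IsPlusHull A) (hxy : x < y) (hy : y < 0) {t : ℝ}
    (ht : (t : ℂ) ∈ excHull x y A) : t < 0 := by
  obtain ⟨a, ha, hat⟩ := ht
  have hay := hA.ne_pole hy ha
  have haim : a.im = 0 := by
    have h := (excInv_im_eq_zero_iff hxy hay).1 (by rw [hat]; simp)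
    exact h
  obtain ⟨r, rfl⟩ : ∃ r : ℝ, a = (r : ℂ) := ⟨a.re, Complex.ext (by simp) (by simp [haim])⟩
  have hrpos : 0 < r := hA.2 r ha
  have ht' : (t : ℂ) = (((x - r) / (r - y) : ℝ) : ℂ) := by
    rw [← hat, excInv]
    push_cast
    ring
  have : t = (x - r) / (r - y) := by exact_mod_cast ht'
  rw [this]
  exact div_neg_of_neg_of_pos (by linarith) (by linarith)

/-- `0 ∉ B`. [folklore] -/
theorem IsPlusHull.zero_notMem_excHull (hA : IsPlusHull A) (hxy : x < y) (hy : y < 0) :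
    (0 : ℂ) ∉ excHull x y A := by
  rintro ⟨a, ha, ha0⟩
  have hay := hA.ne_pole hy ha
  have : a = x := by
    rw [excInv, div_eq_zero_iff] at ha0
    rcases ha0 with h | h
    · exact (sub_eq_zero.1 h).symm
    · exact absurd (sub_eq_zero.1 h) hay
  exact hA.ofReal_notMem_of_neg (hxy.trans hy) (this ▸ ha)

/-- The homeomorphism `m⁻¹ : ℍ ∖ A → ℍ ∖ B` of subtypes. [folklore] -/
def IsPlusHull.excHomeomorph (hA : IsPlusHull A) (hxy : x < y) (hy : y < 0) :
    (upperHalfPlaneSet \ A : Set ℂ) ≃ₜ (upperHalfPlaneSet \ excHull x y A : Set ℂ) where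
  toFun p := ⟨excInv x y p.1, by
    rw [hA.diff_excHull hxy hy]
    exact ⟨p.1, p.2, rfl⟩⟩
  invFun q := ⟨excMap x y q.1, by
    obtain ⟨a, ha, haq⟩ := (hA.diff_excHull hxy hy).subset q.2
    have hay : a ≠ (y : ℂ) := by
      rintro rfl
      simp [UpperHalfPlane.upperHalfPlaneSet] at ha
    rw [← haq, excMap_excInv hxy.ne hay]
    exact ha⟩
  left_inv p := by
    have hpy : (p : ℂ) ≠ (y : ℂ) := by
      rintro h
      have := p.2.1
      rw [h] at this
      simp [UpperHalfPlane.upperHalfPlaneSet] at this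
    exact Subtype.ext (excMap_excInv hxy.ne hpy)
  right_inv q := by
    have hq1 : (q : ℂ) ≠ -1 := by
      rintro h
      have := q.2.1
      rw [h] at this
      simp [UpperHalfPlane.upperHalfPlaneSet] at this
    exact Subtype.ext (excInv_excMap hxy.ne hq1)
  continuous_toFun := by
    refine Continuous.subtype_mk ?_ _
    have hcont : ContinuousOn (excInv x y) (upperHalfPlaneSet \ A) := continuousOn_excInv fun h ↦ by
      simp [UpperHalfPlane.upperHalfPlaneSet] at h
    exact hcont.comp_continuous continuous_subtype_val fun p ↦ p.2
  continuous_invFun := by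
    refine Continuous.subtype_mk ?_ _
    have hcont : ContinuousOn (excMap x y) (upperHalfPlaneSet \ excHull x y A) := continuousOn_excMap fun h ↦ by
      simp [UpperHalfPlane.upperHalfPlaneSet] at h
    exact hcont.comp_continuous continuous_subtype_val fun q ↦ q.2

/-- **`B = m_{x,y}⁻¹(A)` is a `−`-hull** for `A ∈ 𝒬₊` and `x < y < 0`: compact, the closure of its
part in `ℍ` (`m⁻¹` is a homeomorphism near `A`), `ℍ ∖ B ≅ ℍ ∖ A` simply connected, `0 ∉ B`
(`m⁻¹(w) = 0` only for `w = x ∉ A`), and its real points `m⁻¹(a) = (x − a)/(a − y)`, `a > 0`,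
are negative. [folklore] -/
theorem IsPlusHull.isMinusHull_excHull (hA : IsPlusHull A) (hxy : x < y) (hy : y < 0) :
    IsMinusHull (excHull x y A) := by
  refine ⟨⟨⟨(hA.isCompact_excHull hy).isBounded, ?_, ?_⟩, hA.zero_notMem_excHull hxy hy⟩,
    fun t ht ↦ hA.excHull_real_neg hxy hy ht⟩
  · -- `closure (B ∩ ℍ) = B`
    apply Subset.antisymm
    · exact (hA.isCompact_excHull hy).isClosed.closure_subset_iff.2 inter_subset_left
    · rw [hA.excHull_inter hxy hy]
      have hcl : closure (A ∩ upperHalfPlaneSet) = A := hA.1.1.closure_inter_eq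
      have hcont : ContinuousOn (excInv x y) (closure (A ∩ upperHalfPlaneSet)) := by
        rw [hcl]
        exact continuousOn_excInv (hA.pole_notMem hy)
      calc excHull x y A = excInv x y '' closure (A ∩ upperHalfPlaneSet) := by rw [hcl]; rfl
        _ ⊆ closure (excInv x y '' (A ∩ upperHalfPlaneSet)) := hcont.image_closure
  · -- `ℍ ∖ B` is simply connected
    have hsc : IsSimplyConnected (upperHalfPlaneSet \ A) := hA.1.1.2.2
    unfold IsSimplyConnected at hsc ⊢
    exact (hA.excHomeomorph hxy hy).toHomotopyEquiv.simplyConnectedSpace_iff.1 hsc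

/-- `B ∈ 𝒬*`. [folklore] -/
theorem IsPlusHull.isStarHull_excHull (hA : IsPlusHull A) (hxy : x < y) (hy : y < 0) :
    IsStarHull (excHull x y A) :=
  (hA.isMinusHull_excHull hxy hy).1

end Hull

/-! ### `E_A` at real points of `(−∞, x₀)`: real values, real positive derivative -/

section RealPoints

variable {A : Set ℂ} (hA : IsPlusHull A) (hne : A.Nonempty)
include hA hne

/-- `E_A` has the complex derivative `deriv E_A t` at a real point `t < x₀`. [folklore] -/
theorem IsPlusHull.hasDerivAt_extMap_ofReal {t : ℝ} (ht : t < leftPt A) :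
    HasDerivAt (hA.extMap hne) (deriv (hA.extMap hne) t) t :=
  (hA.differentiableAt_extMap hne (hA.ofReal_mem_plusDomain_of_lt hne ht)).hasDerivAt

/-- **The real trace is differentiable with derivative `re E_A'(t)`** at `t < x₀`. [folklore] -/
theorem IsPlusHull.hasDerivAt_realExt {t : ℝ} (ht : t < leftPt A) :
    HasDerivAt (hA.realExt hne) (deriv (hA.extMap hne) t).re t := by
  have h := (hA.hasDerivAt_extMap_ofReal hne ht).comp_ofReal
  exact Complex.reCLM.hasFDerivAt.comp_hasDerivAt t h

/-- `deriv realExt t = re E_A'(t)` for `t < x₀`. [folklore] -/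
theorem IsPlusHull.deriv_realExt {t : ℝ} (ht : t < leftPt A) :
    deriv (hA.realExt hne) t = (deriv (hA.extMap hne) t).re :=
  (hA.hasDerivAt_realExt hne ht).deriv

/-- **`E_A'(t)` is real** at a real point `t < x₀` (`E_A` is real on `(−∞, x₀)`). [folklore] -/
theorem IsPlusHull.deriv_extMap_ofReal {t : ℝ} (ht : t < leftPt A) :
    deriv (hA.extMap hne) t = ((deriv (hA.extMap hne) t).re : ℂ) := by
  -- `s ↦ E_A(s)` agrees near `t` with `s ↦ (realExt s : ℂ)`, whose derivative is real
  have h1 : HasDerivAt (fun s : ℝ ↦ hA.extMap hne s) (deriv (hA.extMap hne) t) t :=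
    (hA.hasDerivAt_extMap_ofReal hne ht).comp_ofReal
  have h2 : HasDerivAt (fun s : ℝ ↦ ((hA.realExt hne s : ℝ) : ℂ)) ((deriv (hA.extMap hne) t).re : ℂ) t :=
    (hA.hasDerivAt_realExt hne ht).ofReal_comp
  have heq : (fun s : ℝ ↦ hA.extMap hne s) =ᶠ[𝓝 t] fun s : ℝ ↦ ((hA.realExt hne s : ℝ) : ℂ) := by
    filter_upwards [Iio_mem_nhds ht] with s hs
    exact hA.extMap_ofReal hne (hA.ofReal_mem_plusDomain_of_lt hne hs)
  exact (h1.congr_of_eventuallyEq heq.symm |>.unique h2)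

/-- **`re E_A'(t) > 0`** at `t < x₀`: nonnegative because the real trace increases, nonzero
because `E_A' ≠ 0`. [folklore] -/
theorem IsPlusHull.deriv_extMap_re_pos {t : ℝ} (ht : t < leftPt A) : 0 < (deriv (hA.extMap hne) t).re := by
  have hne0 : (deriv (hA.extMap hne) t).re ≠ 0 := by
    intro h
    have := hA.deriv_extMap_ofReal hne ht
    rw [h] at this
    exact hA.deriv_extMap_ne_zero hne (hA.ofReal_mem_plusDomain_of_lt hne ht) (by simpa using this)
  have hnn : 0 ≤ (deriv (hA.extMap hne) t).re := by
    rw [← hA.deriv_realExt hne ht, ← derivWithin_of_isOpen isOpen_Iio ht]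
    exact (hA.strictMonoOn_realExt_Iio hne).monotoneOn.derivWithin_nonneg
  exact lt_of_le_of_ne hnn (Ne.symm hne0)

/-- `realExt t < 0` for `t < 0`. [folklore] -/
theorem IsPlusHull.realExt_neg {t : ℝ} (ht : t < 0) : hA.realExt hne t < 0 := by
  have h := hA.strictMonoOn_realExt_Iio hne (ht.trans (hA.leftPt_pos hne)) (hA.leftPt_pos hne) ht
  rwa [hA.realExt_zero hne] at h

/-- `realExt x < realExt y` for `x < y < x₀`. [folklore] -/
theorem IsPlusHull.realExt_lt {x y : ℝ} (hxy : x < y) (hy : y < leftPt A) : hA.realExt hne x < hA.realExt hne y :=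
  hA.strictMonoOn_realExt_Iio hne (hxy.trans hy) hy hxy

/-- `E_A(t) = realExt t` as a complex number, `t < x₀`. [folklore] -/
theorem IsPlusHull.extMap_ofReal_of_lt {t : ℝ} (ht : t < leftPt A) :
    hA.extMap hne t = (hA.realExt hne t : ℂ) :=
  hA.extMap_ofReal hne (hA.ofReal_mem_plusDomain_of_lt hne ht)

end RealPoints

/-! ### The normalising Möbius map `n(u) = c (u − p)/(q − u)` and its inverse -/

/-- `n(u) = c (u − p)/(q − u)`. [folklore] -/
def nMap (c p q : ℝ) (u : ℂ) : ℂ := c * (u - p) / ((q : ℂ) - u)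

/-- `n⁻¹(v) = (q v + c p)/(v + c)`. [folklore] -/
def nInv (c p q : ℝ) (v : ℂ) : ℂ := ((q : ℂ) * v + c * p) / (v + c)

section NMap

variable {c p q : ℝ}

/-- `n(p) = 0`. [folklore] -/
@[simp] theorem nMap_self (c p q : ℝ) : nMap c p q p = 0 := by simp [nMap]

/-- **`Im n(u) = c (q − p) Im u/|q − u|²`.** [folklore] -/
theorem nMap_im (c p q : ℝ) (u : ℂ) : (nMap c p q u).im = c * (q - p) * u.im / normSq ((q : ℂ) - u) := by
  rw [nMap, div_im]
  simp only [mul_re, ofReal_re, sub_re, ofReal_im, sub_im, sub_zero, zero_mul, mul_im, add_zero,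
    zero_sub, mul_neg]
  by_cases h : normSq ((q : ℂ) - u) = 0
  · simp [h]
  · field_simp
    ring

/-- **`Im n⁻¹(v) = c (q − p) Im v/|v + c|²`.** [folklore] -/
theorem nInv_im (c p q : ℝ) (v : ℂ) : (nInv c p q v).im = c * (q - p) * v.im / normSq (v + c) := by
  rw [nInv, div_im]
  simp only [add_re, mul_re, ofReal_re, ofReal_im, zero_mul, sub_zero, add_im, mul_im, add_zero,
    mul_zero]
  by_cases h : normSq (v + (c : ℂ)) = 0
  · simp [h]
  · field_simp
    ring

/-- `n` maps `ℍ` into `ℍ` when `c > 0`, `p < q`. [folklore] -/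
theorem nMap_mem_upperHalfPlaneSet (hc : 0 < c) (hpq : p < q) {u : ℂ} (hu : u ∈ upperHalfPlaneSet) :
    nMap c p q u ∈ upperHalfPlaneSet := by
  have hu' : 0 < u.im := hu
  have hqu : (q : ℂ) - u ≠ 0 := by
    intro h
    have : ((q : ℂ) - u).im = 0 := by rw [h]; simp
    simp at this
    linarith
  show 0 < (nMap c p q u).im
  rw [nMap_im]
  exact div_pos (mul_pos (mul_pos hc (sub_pos.2 hpq)) hu') (normSq_pos.2 hqu)

/-- `n⁻¹` maps `ℍ` into `ℍ` when `c > 0`, `p < q`. [folklore] -/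
theorem nInv_mem_upperHalfPlaneSet (hc : 0 < c) (hpq : p < q) {v : ℂ} (hv : v ∈ upperHalfPlaneSet) :
    nInv c p q v ∈ upperHalfPlaneSet := by
  have hv' : 0 < v.im := hv
  have hvc : v + c ≠ 0 := by
    intro h
    have : (v + c).im = 0 := by rw [h]; simp
    simp at this
    linarith
  show 0 < (nInv c p q v).im
  rw [nInv_im]
  exact div_pos (mul_pos (mul_pos hc (sub_pos.2 hpq)) hv') (normSq_pos.2 hvc)

/-- `n⁻¹ ∘ n = id` off `u = q` (`c ≠ 0`, `p ≠ q`). [folklore] -/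
theorem nInv_nMap (hc : c ≠ 0) (hpq : p ≠ q) {u : ℂ} (hu : u ≠ q) : nInv c p q (nMap c p q u) = u := by
  have hqu : (q : ℂ) - u ≠ 0 := sub_ne_zero.2 (Ne.symm hu)
  have hc' : (c : ℂ) ≠ 0 := by exact_mod_cast hc
  have hpq' : (q : ℂ) - p ≠ 0 := sub_ne_zero.2 (by exact_mod_cast (Ne.symm hpq))
  rw [nInv, nMap]
  have h1 : (q : ℂ) * (c * (u - p) / (q - u)) + c * p = c * u * (q - p) / (q - u) := by
    field_simp
    ring
  have h2 : (c : ℂ) * (u - p) / (q - u) + c = c * (q - p) / (q - u) := by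
    field_simp
    ring
  rw [h1, h2]
  field_simp

/-- `n ∘ n⁻¹ = id` off `v = −c` (`c ≠ 0`, `p ≠ q`). [folklore] -/
theorem nMap_nInv (hc : c ≠ 0) (hpq : p ≠ q) {v : ℂ} (hv : v ≠ -c) : nMap c p q (nInv c p q v) = v := by
  have hvc : v + c ≠ 0 := fun h ↦ hv (eq_neg_of_add_eq_zero_left h)
  have hc' : (c : ℂ) ≠ 0 := by exact_mod_cast hc
  have hpq' : (q : ℂ) - p ≠ 0 := sub_ne_zero.2 (by exact_mod_cast (Ne.symm hpq))
  rw [nInv, nMap]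
  have h1 : (c : ℂ) * (((q : ℂ) * v + c * p) / (v + c) - p) = c * v * (q - p) / (v + c) := by
    field_simp
    ring
  have h2 : (q : ℂ) - ((q : ℂ) * v + c * p) / (v + c) = c * (q - p) / (v + c) := by
    field_simp
    ring
  rw [h1, h2]
  field_simp

/-- `n` is differentiable off `q`. [folklore] -/
theorem differentiableAt_nMap {u : ℂ} (hu : u ≠ q) : DifferentiableAt ℂ (nMap c p q) u := by
  have hqu : (q : ℂ) - u ≠ 0 := sub_ne_zero.2 (Ne.symm hu)
  unfold nMap
  fun_prop (disch := exact hqu)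

/-- `n⁻¹` is differentiable off `−c`. [folklore] -/
theorem differentiableAt_nInv {v : ℂ} (hv : v ≠ -c) : DifferentiableAt ℂ (nInv c p q) v := by
  have hvc : v + c ≠ 0 := fun h ↦ hv (eq_neg_of_add_eq_zero_left h)
  unfold nInv
  fun_prop (disch := exact hvc)

end NMap

/-! ### The restriction map `n ∘ Φ_A ∘ m` of `B = m⁻¹(A)` -/

section ExcRestriction

variable {A : Set ℂ} (hA : IsPlusHull A) (hne : A.Nonempty) {x y : ℝ}

/-- The normalising constant `c = φ'(y)(y − x)/(φ(y) − φ(x))` making `n ∘ Φ_A ∘ m` tangent to the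
identity at `∞`. [folklore] -/
def IsPlusHull.excC (hA : IsPlusHull A) (hne : A.Nonempty) (x y : ℝ) : ℝ :=
  (deriv (hA.extMap hne) y).re * (y - x) / (hA.realExt hne y - hA.realExt hne x)

/-- **`Φ'_B(0) = φ'(x) φ'(y) (y − x)²/(φ(y) − φ(x))²`** for `B = m_{x,y}⁻¹(A)`, with
`φ = realExt` the real trace of `E_A` (`hasRestrictionDeriv_excRestrictionMap`). This is the
ratio `H_{ℍ∖A}(x, y)/H_ℍ(x, y)` of boundary Poisson kernels; it is symmetric in `(x, y)`.
[folklore] -/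
def IsPlusHull.excDeriv (hA : IsPlusHull A) (hne : A.Nonempty) (x y : ℝ) : ℝ :=
  (deriv (hA.extMap hne) x).re * (deriv (hA.extMap hne) y).re * (y - x) ^ 2 /
    (hA.realExt hne y - hA.realExt hne x) ^ 2

/-- `excDeriv` is symmetric. [folklore] -/
theorem IsPlusHull.excDeriv_comm (x y : ℝ) : hA.excDeriv hne x y = hA.excDeriv hne y x := by
  simp only [IsPlusHull.excDeriv]
  rw [show (x - y) ^ 2 = (y - x) ^ 2 by ring,
    show (hA.realExt hne x - hA.realExt hne y) ^ 2 = (hA.realExt hne y - hA.realExt hne x) ^ 2 by ring]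
  ring

include hA hne in
/-- `c > 0` for `x < y < 0`. [folklore] -/
theorem IsPlusHull.excC_pos (hxy : x < y) (hy : y < 0) : 0 < hA.excC hne x y :=
  div_pos (mul_pos (hA.deriv_extMap_re_pos hne (hy.trans (hA.leftPt_pos hne))) (sub_pos.2 hxy))
    (sub_pos.2 (hA.realExt_lt hne hxy (hy.trans (hA.leftPt_pos hne))))

include hA hne in
/-- `Φ'_B(0) > 0` (from the formula) for `x < y < 0`. [folklore] -/
theorem IsPlusHull.excDeriv_pos (hxy : x < y) (hy : y < 0) : 0 < hA.excDeriv hne x y := by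
  have hx0 : x < leftPt A := (hxy.trans hy).trans (hA.leftPt_pos hne)
  have hy0 : y < leftPt A := hy.trans (hA.leftPt_pos hne)
  exact div_pos (mul_pos (mul_pos (hA.deriv_extMap_re_pos hne hx0) (hA.deriv_extMap_re_pos hne hy0))
    (pow_pos (sub_pos.2 hxy) 2)) (pow_pos (sub_pos.2 (hA.realExt_lt hne hxy hy0)) 2)

include hA in
/-- For `z ∈ ℍ ∖ B`, `m(z) ∈ ℍ ∖ A`. [folklore] -/
theorem IsPlusHull.excMap_mem_diff (hxy : x < y) (hy : y < 0) {z : ℂ}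
    (hz : z ∈ upperHalfPlaneSet \ excHull x y A) : excMap x y z ∈ upperHalfPlaneSet \ A := by
  rw [hA.diff_excHull hxy hy] at hz
  obtain ⟨a, ha, rfl⟩ := hz
  have hay : a ≠ (y : ℂ) := by
    rintro rfl
    simp [UpperHalfPlane.upperHalfPlaneSet] at ha
  rwa [excMap_excInv hxy.ne hay]

include hA in
/-- For `w ∈ ℍ ∖ A`, `m⁻¹(w) ∈ ℍ ∖ B`. [folklore] -/
theorem IsPlusHull.excInv_mem_diff (hxy : x < y) (hy : y < 0) {w : ℂ}
    (hw : w ∈ upperHalfPlaneSet \ A) : excInv x y w ∈ upperHalfPlaneSet \ excHull x y A := by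
  rw [hA.diff_excHull hxy hy]
  exact ⟨w, hw, rfl⟩

include hA hne in
/-- For `z ∈ ℍ ∖ B`, `E_A(m(z)) = Φ_A(m(z)) ∈ ℍ`. [folklore] -/
theorem IsPlusHull.extMap_excMap_mem (hxy : x < y) (hy : y < 0) {z : ℂ}
    (hz : z ∈ upperHalfPlaneSet \ excHull x y A) : hA.extMap hne (excMap x y z) ∈ upperHalfPlaneSet := by
  rw [hA.extMap_of_mem_diff hne (hA.excMap_mem_diff hxy hy hz)]
  exact (hA.baseMap hne).mapsTo (hA.excMap_mem_diff hxy hy hz)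

/-- A point of `ℍ` is not `−1`. [folklore] -/
theorem ne_neg_one_of_mem_upperHalfPlaneSet {z : ℂ} (hz : z ∈ upperHalfPlaneSet) : z ≠ -1 := by
  rintro rfl
  simp [UpperHalfPlane.upperHalfPlaneSet] at hz

/-- A point of `ℍ` is not real. [folklore] -/
theorem ne_ofReal_of_mem_upperHalfPlaneSet {z : ℂ} (hz : z ∈ upperHalfPlaneSet) (t : ℝ) : z ≠ t := by
  rintro rfl
  simp [UpperHalfPlane.upperHalfPlaneSet] at hz

/-- **The restriction map `Φ_B = n ∘ Φ_A ∘ m` of `B = m_{x,y}⁻¹(A)`** (`x < y < 0`): `m` carries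
`ℍ ∖ B` onto `ℍ ∖ A`, `Φ_A` (through its extension `E_A`) carries `ℍ ∖ A` onto `ℍ`, and the
Möbius automorphism `n(u) = c (u − φ(x))/(φ(y) − u)` of `ℍ` moves `φ(x) = Φ_A(m(0))` to `0` and
`φ(y) = Φ_A(m(∞))` to `∞`, with `c` chosen so that the composite is tangent to the identity at
`∞`. [folklore] -/
def IsPlusHull.excRestrictionMap (hA : IsPlusHull A) (hne : A.Nonempty) (hxy : x < y) (hy : y < 0) :
    ConformalEquiv (upperHalfPlaneSet \ excHull x y A) upperHalfPlaneSet where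
  toFun z := nMap (hA.excC hne x y) (hA.realExt hne x) (hA.realExt hne y) (hA.extMap hne (excMap x y z))
  invFun v := excInv x y ((hA.baseMap hne).symm
    (nInv (hA.excC hne x y) (hA.realExt hne x) (hA.realExt hne y) v))
  source := upperHalfPlaneSet \ excHull x y A
  target := upperHalfPlaneSet
  map_source' z hz :=
    nMap_mem_upperHalfPlaneSet (hA.excC_pos hne hxy hy) (hA.realExt_lt hne hxy (hy.trans (hA.leftPt_pos hne)))
      (hA.extMap_excMap_mem hne hxy hy hz)
  map_target' v hv :=
    hA.excInv_mem_diff hxy hy ((hA.baseMap hne).symm_mapsTo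
      (nInv_mem_upperHalfPlaneSet (hA.excC_pos hne hxy hy)
        (hA.realExt_lt hne hxy (hy.trans (hA.leftPt_pos hne))) hv))
  left_inv' z hz := by
    have hmz := hA.excMap_mem_diff hxy hy hz
    have hEz := hA.extMap_excMap_mem hne hxy hy hz
    rw [nInv_nMap (hA.excC_pos hne hxy hy).ne' (hA.realExt_lt hne hxy (hy.trans (hA.leftPt_pos hne))).ne
      (ne_ofReal_of_mem_upperHalfPlaneSet hEz _), hA.extMap_of_mem_diff hne hmz,
      (hA.baseMap hne).symm_apply_apply hmz, excInv_excMap hxy.ne (ne_neg_one_of_mem_upperHalfPlaneSet hz.1)]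
  right_inv' v hv := by
    have hc := hA.excC_pos hne hxy hy
    have hpq := hA.realExt_lt hne hxy (hy.trans (hA.leftPt_pos hne))
    have hnv := nInv_mem_upperHalfPlaneSet hc hpq hv
    have hw := (hA.baseMap hne).symm_mapsTo hnv
    rw [excMap_excInv hxy.ne (ne_ofReal_of_mem_upperHalfPlaneSet hw.1 _), hA.extMap_of_mem_diff hne hw,
      (hA.baseMap hne).apply_symm_apply hnv,
      nMap_nInv hc.ne' hpq.ne (ne_ofReal_of_mem_upperHalfPlaneSet hv (-(hA.excC hne x y)) ∘ by simp)]
  source_eq := rfl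
  target_eq := rfl
  differentiableOn z hz := by
    have hmz := hA.excMap_mem_diff hxy hy hz
    have hEz := hA.extMap_excMap_mem hne hxy hy hz
    refine DifferentiableAt.differentiableWithinAt ?_
    have h1 : DifferentiableAt ℂ (fun z ↦ hA.extMap hne (excMap x y z)) z :=
      (hA.differentiableAt_extMap hne (hA.diff_subset_plusDomain hmz)).comp z
        (differentiableAt_excMap (ne_neg_one_of_mem_upperHalfPlaneSet hz.1))
    exact (differentiableAt_nMap (ne_ofReal_of_mem_upperHalfPlaneSet hEz _)).comp z h1
  differentiableOn_symm v hv := by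
    have hc := hA.excC_pos hne hxy hy
    have hpq := hA.realExt_lt hne hxy (hy.trans (hA.leftPt_pos hne))
    have hnv := nInv_mem_upperHalfPlaneSet hc hpq hv
    have hw := (hA.baseMap hne).symm_mapsTo hnv
    refine DifferentiableAt.differentiableWithinAt ?_
    have h1 : DifferentiableAt ℂ (nInv (hA.excC hne x y) (hA.realExt hne x) (hA.realExt hne y)) v :=
      differentiableAt_nInv (ne_ofReal_of_mem_upperHalfPlaneSet hv (-(hA.excC hne x y)) ∘ by simp)
    have h2 : DifferentiableAt ℂ (hA.baseMap hne).invFun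
        (nInv (hA.excC hne x y) (hA.realExt hne x) (hA.realExt hne y) v) :=
      (hA.baseMap hne).differentiableOn_symm.differentiableAt
        (UpperHalfPlane.isOpen_upperHalfPlaneSet.mem_nhds hnv)
    have h12 : DifferentiableAt ℂ (fun v ↦ (hA.baseMap hne).symm
        (nInv (hA.excC hne x y) (hA.realExt hne x) (hA.realExt hne y) v)) v := h2.comp v h1
    exact (differentiableAt_excInv (ne_ofReal_of_mem_upperHalfPlaneSet hw.1 _)).comp v h12

/-- The restriction map of `B` acts as `n ∘ E_A ∘ m`. [folklore] -/
theorem IsPlusHull.excRestrictionMap_apply (hxy : x < y) (hy : y < 0) (z : ℂ) :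
    hA.excRestrictionMap hne hxy hy z =
      nMap (hA.excC hne x y) (hA.realExt hne x) (hA.realExt hne y) (hA.extMap hne (excMap x y z)) :=
  rfl

end ExcRestriction

/-! ### The limits of `Φ_B(z)/z` at `0` and at `∞` -/

section Limits

variable {A : Set ℂ} (hA : IsPlusHull A) (hne : A.Nonempty) {x y : ℝ}

/-- `z ↦ (x − y)/(z + 1)` tends to `0`, avoiding `0`, along `cocompact ℂ ⊓ 𝓟 (ℍ ∖ B)`. [folklore] -/
theorem tendsto_div_add_one_cocompact (hxy : x ≠ y) (S : Set ℂ) (hS : S ⊆ upperHalfPlaneSet) :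
    Tendsto (fun z : ℂ ↦ ((x : ℂ) - y) / (z + 1)) (cocompact ℂ ⊓ 𝓟 S) (𝓝[≠] 0) := by
  have hxy' : (x : ℂ) - y ≠ 0 := sub_ne_zero.2 (by exact_mod_cast hxy)
  refine tendsto_nhdsWithin_iff.2 ⟨?_, ?_⟩
  · refine Tendsto.mono_left ?_ inf_le_left
    rw [← Metric.cobounded_eq_cocompact]
    have h1 : Tendsto (fun z : ℂ ↦ z + 1) (Bornology.cobounded ℂ) (Bornology.cobounded ℂ) := by
      rw [← tendsto_norm_atTop_iff_cobounded]
      have h : Tendsto (fun z : ℂ ↦ ‖z‖ + (-1)) (Bornology.cobounded ℂ) atTop :=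
        tendsto_atTop_add_const_right _ _ tendsto_norm_cobounded_atTop
      refine tendsto_atTop_mono (fun z ↦ ?_) h
      calc ‖z‖ + -1 = ‖z + 1‖ - ‖(1 : ℂ)‖ + (‖z‖ - ‖z + 1‖ + ‖(1 : ℂ)‖ - 1) := by ring
        _ ≤ ‖z + 1‖ := by
            have := norm_sub_norm_le z (z + 1)
            simp only [sub_add_cancel_left, norm_neg, norm_one] at this
            simp only [norm_one]
            linarith
    have h2 : Tendsto (fun z : ℂ ↦ (z + 1)⁻¹) (Bornology.cobounded ℂ) (𝓝 0) :=
      tendsto_inv₀_cobounded.comp h1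
    simpa [div_eq_mul_inv] using h2.const_mul ((x : ℂ) - y)
  · refine mem_inf_of_right ?_
    intro z hz
    have hz1 : z + 1 ≠ 0 := fun h ↦ ne_neg_one_of_mem_upperHalfPlaneSet (hS hz) (eq_neg_of_add_eq_zero_left h)
    exact div_ne_zero hxy' hz1

/-- `z ↦ m(z) − x` tends to `0`, avoiding `0`, as `z → 0`, `z ≠ 0`. [folklore] -/
theorem tendsto_excMap_sub (hxy : x ≠ y) :
    Tendsto (fun z : ℂ ↦ excMap x y z - x) (𝓝[≠] 0) (𝓝[≠] 0) := by
  have hxy' : (y : ℂ) - x ≠ 0 := sub_ne_zero.2 (by exact_mod_cast (Ne.symm hxy))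
  refine tendsto_nhdsWithin_iff.2 ⟨?_, ?_⟩
  · have h : ContinuousAt (fun z : ℂ ↦ excMap x y z - x) 0 :=
      (continuousAt_excMap (by norm_num)).sub continuousAt_const
    have h0 : excMap x y 0 - x = 0 := by simp
    simpa [h0] using h.tendsto.mono_left nhdsWithin_le_nhds
  · -- `m(z) − x = (y − x) z/(z + 1) ≠ 0` for `z ≠ 0` near `0`
    have hball : Metric.ball (0 : ℂ) 1 ∈ 𝓝[≠] (0 : ℂ) := mem_nhdsWithin_of_mem_nhds (Metric.ball_mem_nhds 0 one_pos)
    filter_upwards [hball, self_mem_nhdsWithin] with z hz hz0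
    have hz1 : z ≠ -1 := by
      rintro rfl
      simp at hz
    have hz1' : z + 1 ≠ 0 := fun h ↦ hz1 (eq_neg_of_add_eq_zero_left h)
    rw [mem_compl_iff, mem_singleton_iff, excMap_sub_left hz1]
    exact div_ne_zero (mul_ne_zero hxy' hz0) hz1'

include hA hne in
/-- **`Φ_B(z)/z → Φ'_B(0)` as `z → 0`, `z ≠ 0`.** With `k = m(z) − x → 0`:
`Φ_B(z)/z = c · [(E_A(x + k) − E_A(x))/k] · [(y − x)/(z + 1)] / (φ(y) − E_A(x + k))
→ c φ'(x)(y − x)/(φ(y) − φ(x)) = Φ'_B(0)`. [folklore] -/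
theorem IsPlusHull.tendsto_excRestrictionMap_div_nhds (hxy : x < y) (hy : y < 0) :
    Tendsto (fun z ↦ hA.excRestrictionMap hne hxy hy z / z) (𝓝[≠] 0) (𝓝 (hA.excDeriv hne x y : ℂ)) := by
  have hx0 : x < leftPt A := (hxy.trans hy).trans (hA.leftPt_pos hne)
  have hy0 : y < leftPt A := hy.trans (hA.leftPt_pos hne)
  set c : ℝ := hA.excC hne x y with hc
  set p : ℝ := hA.realExt hne x with hp
  set q : ℝ := hA.realExt hne y with hq
  set E : ℂ → ℂ := hA.extMap hne with hE
  have hpq : p < q := hA.realExt_lt hne hxy hy0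
  have hpq' : (q : ℂ) - p ≠ 0 := sub_ne_zero.2 (by exact_mod_cast hpq.ne')
  have hEx : E x = p := hA.extMap_ofReal_of_lt hne hx0
  have hdx : deriv E x = ((deriv E x).re : ℂ) := hA.deriv_extMap_ofReal hne hx0
  -- the pieces
  have hk := tendsto_excMap_sub hxy.ne (x := x) (y := y)
  have hS : Tendsto (fun z : ℂ ↦ (excMap x y z - x)⁻¹ * (E (x + (excMap x y z - x)) - E x)) (𝓝[≠] 0)
      (𝓝 (deriv E x)) := by
    have h := (hA.hasDerivAt_extMap_ofReal hne hx0).tendsto_slope_zero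
    simp only [smul_eq_mul] at h
    exact h.comp hk
  have hT : Tendsto (fun z : ℂ ↦ ((y : ℂ) - x) / (z + 1)) (𝓝[≠] 0) (𝓝 ((y : ℂ) - x)) := by
    have h : ContinuousAt (fun z : ℂ ↦ ((y : ℂ) - x) / (z + 1)) 0 :=
      continuousAt_const.div (continuousAt_id.add continuousAt_const) (by norm_num)
    simpa using h.tendsto.mono_left nhdsWithin_le_nhds
  have hU : Tendsto (fun z : ℂ ↦ (q : ℂ) - E (x + (excMap x y z - x))) (𝓝[≠] 0) (𝓝 ((q : ℂ) - p)) := by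
    have hcont : ContinuousAt E x := (hA.differentiableAt_extMap hne (hA.ofReal_mem_plusDomain_of_lt hne hx0)).continuousAt
    have h1 : Tendsto (fun z : ℂ ↦ (x : ℂ) + (excMap x y z - x)) (𝓝[≠] 0) (𝓝 x) := by
      simpa using (tendsto_nhdsWithin_iff.1 hk).1.const_add (x : ℂ)
    have h2 := (hcont.tendsto.comp h1).const_sub (q : ℂ)
    rwa [hEx] at h2
  have hlim := ((hS.const_mul (c : ℂ)).mul hT).div hU hpq'
  -- the value of the limit
  have hval : (c : ℂ) * deriv E x * ((y : ℂ) - x) / ((q : ℂ) - p) = (hA.excDeriv hne x y : ℂ) := by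
    have hqp : ((hA.realExt hne y : ℝ) : ℂ) - (hA.realExt hne x : ℝ) ≠ 0 := by simpa [hp, hq] using hpq'
    rw [hdx]
    simp only [hc, hp, hq, hE, IsPlusHull.excC, IsPlusHull.excDeriv]
    push_cast
    field_simp
  rw [← hval]
  refine hlim.congr' ?_
  -- the algebraic identity, valid for `z ≠ 0` near `0`
  have hball : Metric.ball (0 : ℂ) 1 ∈ 𝓝[≠] (0 : ℂ) := mem_nhdsWithin_of_mem_nhds (Metric.ball_mem_nhds 0 one_pos)
  filter_upwards [hball, self_mem_nhdsWithin] with z hz hz0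
  have hz1 : z ≠ -1 := by
    rintro rfl
    simp at hz
  have hz1' : z + 1 ≠ 0 := fun h ↦ hz1 (eq_neg_of_add_eq_zero_left h)
  have hyx : (y : ℂ) - x ≠ 0 := sub_ne_zero.2 (by exact_mod_cast hxy.ne')
  have hk0 : excMap x y z - x ≠ 0 := by
    rw [excMap_sub_left hz1]
    exact div_ne_zero (mul_ne_zero hyx hz0) hz1'
  rw [hA.excRestrictionMap_apply hne hxy hy, nMap]
  simp only [Pi.div_apply]
  rw [show (x : ℂ) + (excMap x y z - x) = excMap x y z by ring, hEx]
  rw [excMap_sub_left hz1] at hk0 ⊢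
  field_simp
  ring

include hA hne in
/-- **`Φ'_B(0) = φ'(x)φ'(y)(y − x)²/(φ(y) − φ(x))²`**: the restriction map of `B = m_{x,y}⁻¹(A)`
has restriction derivative `excDeriv x y`. [folklore] -/
theorem IsPlusHull.hasRestrictionDeriv_excRestrictionMap (hxy : x < y) (hy : y < 0) :
    HasRestrictionDeriv (excHull x y A) (hA.excRestrictionMap hne hxy hy) (hA.excDeriv hne x y) :=
  (hA.tendsto_excRestrictionMap_div_nhds hne hxy hy).mono_left
    (nhdsWithin_mono _ fun z hz ↦ mem_compl_singleton_iff.2 (fun h ↦ by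
      have := hz.1
      rw [h] at this
      simp [UpperHalfPlane.upperHalfPlaneSet] at this))

include hA hne in
/-- **`Φ_B(z)/z → 1` at `∞`.** With `h = (x − y)/(z + 1) → 0`, `m(z) = y + h` and
`z = (x − y − h)/h`, so that
`Φ_B(z)/z = c (E_A(y + h) − φ(x))/(x − y − h) · (−1/[(E_A(y + h) − E_A(y))/h])
→ c (φ(y) − φ(x))/((y − x) φ'(y)) = 1`. [folklore] -/
theorem IsPlusHull.tendsto_excRestrictionMap_div_cocompact (hxy : x < y) (hy : y < 0) :
    Tendsto (fun z ↦ hA.excRestrictionMap hne hxy hy z / z)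
      (cocompact ℂ ⊓ 𝓟 (upperHalfPlaneSet \ excHull x y A)) (𝓝 1) := by
  have hx0 : x < leftPt A := (hxy.trans hy).trans (hA.leftPt_pos hne)
  have hy0 : y < leftPt A := hy.trans (hA.leftPt_pos hne)
  set c : ℝ := hA.excC hne x y with hc
  set p : ℝ := hA.realExt hne x with hp
  set q : ℝ := hA.realExt hne y with hq
  set E : ℂ → ℂ := hA.extMap hne with hE
  have hpq : p < q := hA.realExt_lt hne hxy hy0
  have hEy : E y = q := hA.extMap_ofReal_of_lt hne hy0
  have hdy : deriv E y = ((deriv E y).re : ℂ) := hA.deriv_extMap_ofReal hne hy0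
  have hdy0 : 0 < (deriv E y).re := hA.deriv_extMap_re_pos hne hy0
  have hdy' : deriv E y ≠ 0 := by
    rw [hdy]
    exact_mod_cast hdy0.ne'
  have hxy' : (x : ℂ) - y ≠ 0 := sub_ne_zero.2 (by exact_mod_cast hxy.ne)
  -- `h = (x − y)/(z + 1) → 0`, `h ≠ 0`
  have hh := tendsto_div_add_one_cocompact hxy.ne (upperHalfPlaneSet \ excHull x y A) fun _ h ↦ h.1
  -- the limit of `R(h) = c (E(y + h) − p)/(x − y − h) · (−1/(h⁻¹ (E(y + h) − E y)))` as `h → 0`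
  have hR : Tendsto (fun h : ℂ ↦ (c : ℂ) * (E (y + h) - p) / ((x : ℂ) - y - h) *
      (-1 / (h⁻¹ * (E (y + h) - E y)))) (𝓝[≠] 0) (𝓝 1) := by
    have hcont : ContinuousAt E y := (hA.differentiableAt_extMap hne (hA.ofReal_mem_plusDomain_of_lt hne hy0)).continuousAt
    have h1 : Tendsto (fun h : ℂ ↦ (c : ℂ) * (E (y + h) - p)) (𝓝[≠] 0) (𝓝 ((c : ℂ) * (q - p))) := by
      have ha : Tendsto (fun h : ℂ ↦ (y : ℂ) + h) (𝓝[≠] 0) (𝓝 y) := by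
        have h0 : Tendsto (fun h : ℂ ↦ (y : ℂ) + h) (𝓝 0) (𝓝 ((y : ℂ) + 0)) :=
          ((continuous_const.add continuous_id).tendsto 0)
        rw [add_zero] at h0
        exact h0.mono_left nhdsWithin_le_nhds
      have hb := ((hcont.tendsto.comp ha).sub_const (p : ℂ)).const_mul (c : ℂ)
      rwa [hEy] at hb
    have h2 : Tendsto (fun h : ℂ ↦ (x : ℂ) - y - h) (𝓝[≠] 0) (𝓝 ((x : ℂ) - y)) := by
      have : ContinuousAt (fun h : ℂ ↦ (x : ℂ) - y - h) 0 := continuousAt_const.sub continuousAt_id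
      simpa using this.tendsto.mono_left nhdsWithin_le_nhds
    have h3 : Tendsto (fun h : ℂ ↦ h⁻¹ * (E (y + h) - E y)) (𝓝[≠] 0) (𝓝 (deriv E y)) := by
      have h := (hA.hasDerivAt_extMap_ofReal hne hy0).tendsto_slope_zero
      simpa only [smul_eq_mul] using h
    have h4 : Tendsto (fun h : ℂ ↦ -1 / (h⁻¹ * (E (y + h) - E y))) (𝓝[≠] 0) (𝓝 (-1 / deriv E y)) :=
      tendsto_const_nhds.div h3 hdy'
    have hlim := ((h1.div h2 hxy').mul h4)
    have hval : (c : ℂ) * (q - p) / ((x : ℂ) - y) * (-1 / deriv E y) = 1 := by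
      have hqp : ((hA.realExt hne y : ℝ) : ℂ) - (hA.realExt hne x : ℝ) ≠ 0 :=
        sub_ne_zero.2 (by exact_mod_cast (hq ▸ hp ▸ hpq).ne')
      have hd0 : ((deriv (hA.extMap hne) y).re : ℂ) ≠ 0 := by exact_mod_cast (hE ▸ hdy0).ne'
      rw [hdy]
      simp only [hc, hp, hq, hE, IsPlusHull.excC]
      push_cast
      field_simp
      ring
    rwa [hval] at hlim
  refine (hR.comp hh).congr' ?_
  -- the algebraic identity `Φ_B(z)/z = R(h(z))` on `ℍ ∖ B`
  refine mem_inf_of_right ?_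
  intro z hz
  have hz1 : z ≠ -1 := ne_neg_one_of_mem_upperHalfPlaneSet hz.1
  have hz1' : z + 1 ≠ 0 := fun h ↦ hz1 (eq_neg_of_add_eq_zero_left h)
  have hEz : E (excMap x y z) ∈ upperHalfPlaneSet := hA.extMap_excMap_mem hne hxy hy hz
  have hEq : E (excMap x y z) - q ≠ 0 := sub_ne_zero.2 (ne_ofReal_of_mem_upperHalfPlaneSet hEz q)
  have hEq' : (q : ℂ) - E (excMap x y z) ≠ 0 := sub_ne_zero.2 (ne_ofReal_of_mem_upperHalfPlaneSet hEz q).symm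
  have hh0 : ((x : ℂ) - y) / (z + 1) ≠ 0 := div_ne_zero hxy' hz1'
  have hmz : excMap x y z = y + ((x : ℂ) - y) / (z + 1) := excMap_eq hz1
  simp only [Function.comp_apply, mem_setOf_eq]
  rw [hA.excRestrictionMap_apply hne hxy hy, nMap, ← hmz, hEy]
  simp only [← hc, ← hp, ← hq, ← hE]
  have hz0 : z ≠ 0 := fun h ↦ by
    have := hz.1
    rw [h] at this
    simp [UpperHalfPlane.upperHalfPlaneSet] at this
  have hxyh : (x : ℂ) - y - ((x : ℂ) - y) / (z + 1) = ((x : ℂ) - y) * z / (z + 1) := by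
    field_simp
    ring
  rw [hxyh]
  field_simp
  ring

include hA hne in
/-- **`n ∘ Φ_A ∘ m` is a restriction map of `B = m_{x,y}⁻¹(A)`**: boundary value `0` at `0`
(since `Φ_B(z) = (Φ_B(z)/z) · z`) and `Φ_B(z)/z → 1` at `∞`.
[cite: LawlerSchrammWerner2003Restriction, §2 p. 8 (the maps Φ_A)] -/
theorem IsPlusHull.isRestrictionMap_excRestrictionMap (hxy : x < y) (hy : y < 0) :
    IsRestrictionMap (excHull x y A) (hA.excRestrictionMap hne hxy hy) := by
  refine ⟨?_, hA.tendsto_excRestrictionMap_div_cocompact hne hxy hy⟩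
  have hd := hA.hasRestrictionDeriv_excRestrictionMap hne hxy hy
  have hz : Tendsto (fun z : ℂ ↦ z) (𝓝[upperHalfPlaneSet \ excHull x y A] 0) (𝓝 0) :=
    tendsto_id.mono_left nhdsWithin_le_nhds
  have h := hd.mul hz
  rw [mul_zero] at h
  refine h.congr' ?_
  filter_upwards [self_mem_nhdsWithin] with z hz'
  have hz0 : z ≠ 0 := fun h ↦ by
    have := hz'.1
    rw [h] at this
    simp [UpperHalfPlane.upperHalfPlaneSet] at this
  exact div_mul_cancel₀ _ hz0

end Limits

/-! ### Consequences: `Φ'_B(0)` is THE restriction derivative of `B`; avoidance probabilities -/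

section Consequences

variable {A : Set ℂ} (hA : IsPlusHull A) (hne : A.Nonempty) {x y : ℝ}
include hA hne

/-- **Every restriction derivative of `B = m_{x,y}⁻¹(A)` equals `excDeriv x y`** (restriction
maps of a `*`-hull agree on `ℍ ∖ B`, [LSW] §2 p. 8, the tree's
`IsStarHull.existsUnique_isRestrictionMap_holds`). [cite: LawlerSchrammWerner2003Restriction, §2 p. 8 (uniqueness of Φ_A)] -/
theorem IsPlusHull.eq_excDeriv_of_hasRestrictionDeriv (hxy : x < y) (hy : y < 0)
    {Ψ : ConformalEquiv (upperHalfPlaneSet \ excHull x y A) upperHalfPlaneSet}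
    (hΨ : IsRestrictionMap (excHull x y A) Ψ) {d : ℝ} (hd : HasRestrictionDeriv (excHull x y A) Ψ d) :
    d = hA.excDeriv hne x y := by
  have hB := hA.isStarHull_excHull hxy hy
  obtain ⟨Φ₀, -, huniq⟩ := IsStarHull.existsUnique_isRestrictionMap_holds hB
  have h1 : EqOn Ψ Φ₀ (upperHalfPlaneSet \ excHull x y A) := huniq Ψ hΨ
  have h2 : EqOn (hA.excRestrictionMap hne hxy hy) Φ₀ (upperHalfPlaneSet \ excHull x y A) :=
    huniq _ (hA.isRestrictionMap_excRestrictionMap hne hxy hy)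
  have hd' : HasRestrictionDeriv (excHull x y A) (hA.excRestrictionMap hne hxy hy) d := by
    refine (hd.congr' ?_)
    filter_upwards [self_mem_nhdsWithin] with z hz
    rw [h1 hz, h2 hz]
  exact HasRestrictionDeriv.unique hB hd' (hA.hasRestrictionDeriv_excRestrictionMap hne hxy hy)

/-- **`0 < Φ'_B(0) ≤ 1`** for `B = m_{x,y}⁻¹(A)` ([LSW] (2.4), the tree's
`IsStarHull.exists_hasRestrictionDeriv_holds`): in particular `excDeriv x y ≤ 1`.
[cite: LawlerSchrammWerner2003Restriction, §2 (2.4) p. 7] -/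
theorem IsPlusHull.excDeriv_le_one (hxy : x < y) (hy : y < 0) : hA.excDeriv hne x y ≤ 1 := by
  obtain ⟨d, -, hd1, hd⟩ := IsStarHull.exists_hasRestrictionDeriv_holds (hA.isStarHull_excHull hxy hy)
    (hA.isRestrictionMap_excRestrictionMap hne hxy hy)
  rwa [hA.eq_excDeriv_of_hasRestrictionDeriv hne hxy hy (hA.isRestrictionMap_excRestrictionMap hne hxy hy) hd] at hd1

/-- `excDeriv x y ≤ 1` for all `x ≠ y` in `(−∞, 0)` (symmetry). [cite: LawlerSchrammWerner2003Restriction, §2 (2.4) p. 7] -/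
theorem IsPlusHull.excDeriv_le_one_of_ne (hx : x < 0) (hy : y < 0) (hxy : x ≠ y) : hA.excDeriv hne x y ≤ 1 := by
  rcases hxy.lt_or_gt with h | h
  · exact hA.excDeriv_le_one hne h hy
  · rw [hA.excDeriv_comm hne]
    exact hA.excDeriv_le_one hne h hx

/-- **The avoidance probability of the hung hull under a two-sided restriction measure**:
`P_α[K ∩ m_{x,y}⁻¹(A) = ∅] = Φ'_B(0)^α = (φ'(x)φ'(y)(y − x)²/(φ(y) − φ(x))²)^α` — i.e. the
probability that the sample hung between `x` and `y`, `m_{x,y}(K)`, avoids `A`.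
[cite: LawlerSchrammWerner2003Restriction, Prop. 3.3 (3) / Def. 3.4 (pp. 10–11)] -/
theorem IsRestrictionMeasure.measure_avoid_excHull {α : ℝ} {P : Measure RestrictionConfig}
    (hP : IsRestrictionMeasure α P) (hxy : x < y) (hy : y < 0) :
    P (RestrictionConfig.avoid (excHull x y A)) = ENNReal.ofReal (hA.excDeriv hne x y ^ α) :=
  hP.2 (hA.isStarHull_excHull hxy hy) (hA.isRestrictionMap_excRestrictionMap hne hxy hy)
    (hA.hasRestrictionDeriv_excRestrictionMap hne hxy hy)

/-- **The excursion kernel of `A` is nonnegative**: for `x ≠ y` in `(−∞, 0)`,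
`(x − y)⁻² − φ'(x)φ'(y)(φ(x) − φ(y))⁻² = (x − y)⁻² (1 − Φ'_{B_{x,y}}(0)) ≥ 0`, `φ = realExt`,
`φ' = (E_A)'|_ℝ`. [folklore] -/
theorem IsPlusHull.excKernel_eq (hxy : x ≠ y) :
    ((x - y) ^ 2)⁻¹ - (deriv (hA.extMap hne) x).re * (deriv (hA.extMap hne) y).re /
        (hA.realExt hne x - hA.realExt hne y) ^ 2 =
      ((x - y) ^ 2)⁻¹ * (1 - hA.excDeriv hne x y) := by
  have h : (x - y) ^ 2 ≠ 0 := pow_ne_zero 2 (sub_ne_zero.2 hxy)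
  rw [IsPlusHull.excDeriv, show (hA.realExt hne x - hA.realExt hne y) ^ 2 =
    (hA.realExt hne y - hA.realExt hne x) ^ 2 by ring, show (y - x) ^ 2 = (x - y) ^ 2 by ring]
  by_cases h' : (hA.realExt hne y - hA.realExt hne x) ^ 2 = 0
  · simp [h']
  · field_simp

/-- The excursion kernel is nonnegative off the diagonal of `(−∞, 0)²`. [folklore] -/
theorem IsPlusHull.excKernel_nonneg (hx : x < 0) (hy : y < 0) (hxy : x ≠ y) :
    0 ≤ ((x - y) ^ 2)⁻¹ - (deriv (hA.extMap hne) x).re * (deriv (hA.extMap hne) y).re /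
        (hA.realExt hne x - hA.realExt hne y) ^ 2 := by
  rw [hA.excKernel_eq hne hxy]
  exact mul_nonneg (inv_nonneg.2 (sq_nonneg _)) (sub_nonneg.2 (hA.excDeriv_le_one_of_ne hne hx hy hxy))

end Consequences

/-! ### The total mass of hung samples hitting `A`: `∬ (x − y)⁻² (1 − Φ'_{B_{x,y}}(0)) = −log Φ'_A(0)` -/

section Mass

variable {A : Set ℂ} (hA : IsPlusHull A) (hne : A.Nonempty)

/-- The real trace `φ = realExt`, cut off to a measurable function: `φ` on `(−∞, x₀/2)`, `0`
elsewhere (only its values and derivatives on `(−∞, x₀/2)` matter). [folklore] -/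
def IsPlusHull.excTrace (hA : IsPlusHull A) (hne : A.Nonempty) : ℝ → ℝ :=
  (Iio (leftPt A / 2)).piecewise (hA.realExt hne) 0

include hA hne

/-- `excTrace = realExt` on `(−∞, x₀/2)`. [folklore] -/
theorem IsPlusHull.excTrace_of_lt {t : ℝ} (ht : t < leftPt A / 2) : hA.excTrace hne t = hA.realExt hne t :=
  Set.piecewise_eq_of_mem _ _ _ ht

/-- `excTrace = realExt` near every point of `(−∞, x₀/2)`. [folklore] -/
theorem IsPlusHull.excTrace_eventuallyEq {t : ℝ} (ht : t < leftPt A / 2) :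
    hA.excTrace hne =ᶠ[𝓝 t] hA.realExt hne := by
  filter_upwards [Iio_mem_nhds ht] with s hs
  exact hA.excTrace_of_lt hne hs

/-- `deriv excTrace t = re E_A'(t)` for `t < x₀/2`. [folklore] -/
theorem IsPlusHull.deriv_excTrace {t : ℝ} (ht : t < leftPt A / 2) :
    deriv (hA.excTrace hne) t = (deriv (hA.extMap hne) t).re := by
  rw [(hA.excTrace_eventuallyEq hne ht).deriv_eq, hA.deriv_realExt hne (ht.trans (hA.half_leftPt_lt hne))]

/-- **The real trace is `C^∞` on `(−∞, x₀/2)`** (it is the restriction to the real axis of the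
holomorphic `E_A`). [folklore] -/
theorem IsPlusHull.contDiffOn_excTrace {n : WithTop ℕ∞} : ContDiffOn ℝ n (hA.excTrace hne) (Iio (leftPt A / 2)) := by
  have h1 : ContDiffOn ℂ n (hA.extMap hne) (plusDomain A) :=
    (hA.differentiableOn_extMap hne).contDiffOn hA.isOpen_plusDomain
  have h2 : ContDiffOn ℝ n (fun t : ℝ ↦ hA.extMap hne t) (Iio (leftPt A / 2)) :=
    (h1.restrict_scalars ℝ).comp Complex.ofRealCLM.contDiff.contDiffOn fun t ht ↦
      hA.ofReal_mem_plusDomain_of_lt hne ((mem_Iio.1 ht).trans (hA.half_leftPt_lt hne))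
  have h3 : ContDiffOn ℝ n (hA.realExt hne) (Iio (leftPt A / 2)) :=
    Complex.reCLM.contDiff.comp_contDiffOn h2
  exact h3.congr fun t ht ↦ hA.excTrace_of_lt hne ht

/-- `excTrace 0 = 0`. [folklore] -/
theorem IsPlusHull.excTrace_zero : hA.excTrace hne 0 = 0 := by
  rw [hA.excTrace_of_lt hne (hA.half_leftPt_pos hne), hA.realExt_zero hne]

/-- `(excTrace)' > 0` on `(−∞, x₀/2)`. [folklore] -/
theorem IsPlusHull.deriv_excTrace_pos {t : ℝ} (ht : t < leftPt A / 2) : 0 < deriv (hA.excTrace hne) t := by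
  rw [hA.deriv_excTrace hne ht]
  exact hA.deriv_extMap_re_pos hne (ht.trans (hA.half_leftPt_lt hne))

/-- **`excTrace t / t → 1` as `t → −∞`** (from `E_A(z)/z → 1` at `∞`). [folklore] -/
theorem IsPlusHull.tendsto_excTrace_div : Tendsto (fun t ↦ hA.excTrace hne t / t) atBot (𝓝 1) := by
  have h1 : Tendsto (fun t : ℝ ↦ hA.extMap hne t / t) atBot (𝓝 1) := by
    have h := hA.tendsto_extMap_div hne
    rw [← Metric.cobounded_eq_cocompact] at h
    exact h.comp (RCLike.tendsto_ofReal_atBot_cobounded ℂ)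
  have h2 : Tendsto (fun t : ℝ ↦ (hA.extMap hne t / t).re) atBot (𝓝 1) := by
    have h := (Complex.continuous_re.tendsto 1).comp h1
    rwa [Complex.one_re] at h
  refine h2.congr' ?_
  filter_upwards [eventually_lt_atBot (min 0 (leftPt A / 2))] with t ht
  have ht0 : t < 0 := ht.trans_le (min_le_left _ _)
  have ht2 : t < leftPt A / 2 := ht.trans_le (min_le_right _ _)
  rw [hA.excTrace_of_lt hne ht2, hA.extMap_ofReal_of_lt hne (ht2.trans (hA.half_leftPt_lt hne)),
    ← Complex.ofReal_div, Complex.ofReal_re]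

/-- `excTrace` is measurable. [folklore] -/
theorem IsPlusHull.measurable_excTrace : Measurable (hA.excTrace hne) :=
  ContinuousOn.measurable_piecewise
    ((hA.continuousOn_realExt_Iio hne).mono (Iio_subset_Iio (hA.half_leftPt_lt hne).le))
    continuousOn_const measurableSet_Iio

/-- `deriv excTrace 0 = Φ'_A(0)`. [cite: LawlerSchrammWerner2003Restriction, §2 (2.4) p. 7] -/
theorem IsPlusHull.deriv_excTrace_zero {Φ : ConformalEquiv (upperHalfPlaneSet \ A) upperHalfPlaneSet}
    (hΦ : IsRestrictionMap A Φ) {d : ℝ} (hd : HasRestrictionDeriv A Φ d) : deriv (hA.excTrace hne) 0 = d := by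
  rw [hA.deriv_excTrace hne (hA.half_leftPt_pos hne)]
  have h := hA.hasDerivAt_extMap_zero hne hΦ hd
  rw [show ((0 : ℝ) : ℂ) = 0 from rfl, h.deriv]
  simp

/-- **The mass of hung samples hitting `A`.** For a nonempty `A ∈ 𝒬₊` with `Φ'_A(0) = d`:

  `∫⁻_{(−∞,0)²} (x − y)⁻² (1 − Φ'_{m_{x,y}⁻¹(A)}(0)) d(x, y) = −log d`,

where `1 − Φ'_{m_{x,y}⁻¹(A)}(0) = P_1[m_{x,y}(K) ∩ A ≠ ∅]` is the probability that a two-sided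
restriction sample of exponent `1` hung between `x` and `y` hits `A`
(`IsRestrictionMeasure.measure_avoid_excHull`); so the σ-finite measure
`(x − y)⁻² dx dy ⊗ m_{x,y}(P_1)` of hung samples gives "hits `A`" the mass `−log Φ'_A(0)`. The
excursion-kernel identity (`ExcursionKernel.setLIntegral_prod_excursionKernel`) applied to the
real trace of `E_A`. [folklore] -/
theorem IsPlusHull.setLIntegral_prod_one_sub_excDeriv
    {Φ : ConformalEquiv (upperHalfPlaneSet \ A) upperHalfPlaneSet}
    (hΦ : IsRestrictionMap A Φ) {d : ℝ} (hd : HasRestrictionDeriv A Φ d) :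
    ∫⁻ p in Iio (0 : ℝ) ×ˢ Iio (0 : ℝ), ENNReal.ofReal (((p.1 - p.2) ^ 2)⁻¹ * (1 - hA.excDeriv hne p.1 p.2)) =
      ENNReal.ofReal (-Real.log d) := by
  have hε : 0 < leftPt A / 2 := hA.half_leftPt_pos hne
  set φ := hA.excTrace hne with hφdef
  have hker : ∀ x y : ℝ, x < 0 → y < 0 →
      ((x - y) ^ 2)⁻¹ * (1 - hA.excDeriv hne x y) =
        ((x - y) ^ 2)⁻¹ - deriv φ x * deriv φ y / (φ x - φ y) ^ 2 := by
    intro x y hx hy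
    rw [hφdef, hA.deriv_excTrace hne (hx.trans hε), hA.deriv_excTrace hne (hy.trans hε),
      hA.excTrace_of_lt hne (hx.trans hε), hA.excTrace_of_lt hne (hy.trans hε)]
    rcases eq_or_ne x y with rfl | hxy
    · simp
    · exact (hA.excKernel_eq hne hxy).symm
  calc ∫⁻ p in Iio (0 : ℝ) ×ˢ Iio (0 : ℝ), ENNReal.ofReal (((p.1 - p.2) ^ 2)⁻¹ * (1 - hA.excDeriv hne p.1 p.2))
      = ∫⁻ p in Iio (0 : ℝ) ×ˢ Iio (0 : ℝ),
          ENNReal.ofReal (((p.1 - p.2) ^ 2)⁻¹ - deriv φ p.1 * deriv φ p.2 / (φ p.1 - φ p.2) ^ 2) :=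
        setLIntegral_congr_fun (measurableSet_Iio.prod measurableSet_Iio) fun p hp ↦ by
          rw [hker p.1 p.2 hp.1 hp.2]
    _ = ENNReal.ofReal (-Real.log (deriv φ 0)) := by
        refine ExcursionKernel.setLIntegral_prod_excursionKernel hε (hA.contDiffOn_excTrace hne)
          (hA.excTrace_zero hne) (fun t ht ↦ hA.deriv_excTrace_pos hne ht) (hA.tendsto_excTrace_div hne)
          (hA.measurable_excTrace hne) fun x y hx hy hxy ↦ ?_
        rw [← hker x y hx hy]
        exact mul_nonneg (inv_nonneg.2 (sq_nonneg _)) (sub_nonneg.2 (hA.excDeriv_le_one_of_ne hne hx hy hxy))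
    _ = ENNReal.ofReal (-Real.log d) := by rw [hA.deriv_excTrace_zero hne hΦ hd]

end Mass

end Literature.Probability.RandomPlanarGeometry

end
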